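import Mathlib
import HarnessLib
import Summits.QuantumFields.QCD.Theses.NestedDissectionSea
import Literature.Barriers.QuantumFields.WilsonDeterminantMassSplitting

/-!
# Sketch — crux-ideate stmt-QuantumFields-13901 (CoerciveSea), round 1, ideator 2

First lemmas of the two idea cards of this seat, stated over existing declarations
(`wilsonCell`, `HasSingularSeparator`, `wilsonBox`, `spinorLift`, `gammaFive`, `euclideanGamma`,
`fundamentalRep`, `wilsonMeasure`, `QCDRegularisation`, the route decl `CoerciveSea`, and the
barrier vocabulary `WilsonSign.IsGammaHermitian`). Nothing here is proved; everything is a `Prop`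
(statement shapes for triage / crux-plan), so the file is sorry-free.

* Card `twisted-spectral-sum`: `twistedSum`, `TwistedCount` (first lemma), `CellGammaHermitian`,
  `CellTwistedSquare`, the transfer `TwistedSumLaw` (C⁺) and the `Reduction` shape.
* Card `haar-link-gradient`: `rotateLink`, `chiralLinkAmplitude`, `LinkSpeedIdentity`
  (first lemma: exact law of motion of the Hermitian cell form under one link rotation),
  `HaarTranslationAveraging` (the generic spectral-averaging-by-left-translation inequality).
-/

open scoped BigOperators Matrix ComplexConjugate ENNReal
open MeasureTheory Filter Matrix
open Literature.MathematicalPhysics.QuantumLattice Literature.MathematicalPhysics.QuantumFieldTheory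
  Literature.Probability.LatticeModels

noncomputable section

namespace Summit.QuantumFields.QCD.Cruxes.CoerciveSea.Ideator2

/-- Local notation: the colour group `SU(3)`. -/
local notation "𝔾" => Matrix.specialUnitaryGroup (Fin 3) ℂ

variable {N : ℕ} [NeZero N]

/-! ## Card A — twisted-spectral-sum -/

/-- `Γ₅` restricted to the corner-`0` open box of sides `s`: the principal submatrix of
`spinorLift gammaFive = 1 ⊗ 1 ⊗ γ₅` (site/colour-diagonal, so restriction commutes with it). -/
def cellGammaFive (s : Fin 4 → ℕ) :
    Matrix {p // wilsonBox (0 : TorusSite 4 N) s p} {p // wilsonBox (0 : TorusSite 4 N) s p} ℂ :=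
  Matrix.toSquareBlockProp
    (spinorLift gammaFive : Matrix (TorusSite 4 N × Fin 3 × Fin 4) (TorusSite 4 N × Fin 3 × Fin 4) ℂ)
    (wilsonBox (0 : TorusSite 4 N) s)

/-- The **smoothed Weyl count** of the Dirichlet cell at twisted mass `τ`:
`𝔖(U, μ, s, τ) = 8 τ⁶ Re Tr [(D_c† D_c + τ²)⁻¹]³ = 8 Σ_i (τ²/(σ_i² + τ²))³` over the singular values
`σ_i` of `D_c = wilsonCell U μ 0 s` — the third twisted-mass spectral sum of the cell (Giusti–Lüscher
spectral sums of `D†D + μ²`, here on a Dirichlet cell), normalised so that every singular value below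
`τ` contributes at least `1`. -/
def twistedSum (U : GaugeConfig 4 N 𝔾) (μ : ℝ) (s : Fin 4 → ℕ) (τ : ℝ) : ℝ :=
  8 * τ ^ 6 *
    ((((wilsonCell U μ 0 s)ᴴ * wilsonCell U μ 0 s +
        ((τ ^ 2 : ℝ) : ℂ) • (1 : Matrix {p // wilsonBox (0 : TorusSite 4 N) s p}
          {p // wilsonBox (0 : TorusSite 4 N) s p} ℂ))⁻¹) ^ 3).trace.re

/-- **FIRST LEMMA of card A (deterministic, provable now, size M).** A `τ`-singular separator forces
a cell vector `w ≠ 0` with `‖D_c w‖ < τ ‖w‖` (the refuter's inclusion: `D_c w` vanishes on the children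
interiors), hence `λ_min(D_c†D_c) < τ²`, hence `Tr (D_c†D_c + τ²)⁻³ ≥ (λ_min + τ²)⁻³ > (2τ²)⁻³`:
the smoothed count is at least `1`. With `HasSingularSeparator.mono` this is all the spectral
information clause (i) ever uses. -/
def TwistedCount : Prop :=
  ∀ (N : ℕ) [NeZero N] (U : GaugeConfig 4 N 𝔾) (μ : ℝ) (s : Fin 4 → ℕ) (τ : ℝ),
    0 < τ → HasSingularSeparator U μ s τ → 1 ≤ twistedSum U μ s τ

/-- `γ₅`-hermiticity survives Dirichlet restriction: the cell matrix is `Γ₅ᶜ`-Hermitian in the sense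
of the barrier vocabulary (`Γ D Γ = Dᴴ`, `Γ² = 1`), because `Γ₅ = spinorLift gammaFive` is
site/colour-diagonal (`spinorLift_gammaFive_eq_diagonal`) — the ingredient of route support
`DirichletDetReal`. Provable now (size S). -/
def CellGammaHermitian : Prop :=
  ∀ (N : ℕ) [NeZero N] (U : GaugeConfig 4 N 𝔾) (μ : ℝ) (s : Fin 4 → ℕ),
    Literature.Barriers.QuantumFields.WilsonSign.IsGammaHermitian (cellGammaFive s) (wilsonCell U μ 0 s)

/-- **Wegner's `iε` is the twisted mass.** On every Dirichlet cell,
`(D_c + iτΓ₅ᶜ)ᴴ (D_c + iτΓ₅ᶜ) = D_cᴴ D_c + τ²` (cross terms cancel by `CellGammaHermitian`), so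
`‖(D_c + iτΓ₅ᶜ)⁻¹‖ ≤ 1/τ` for EVERY gauge field (no exceptional configurations, Frezzotti–Grassi–
Sint–Weisz 2001 §1) and `(D_cᴴD_c + τ²)⁻¹ = G_τ G_τᴴ` with `G_τ = (D_c + iτΓ₅ᶜ)⁻¹` the twisted cell
propagator: `twistedSum = 8τ⁶ Tr (G_τ G_τᴴ)³`. Provable now (size S) from `CellGammaHermitian`. -/
def CellTwistedSquare : Prop :=
  ∀ (N : ℕ) [NeZero N] (U : GaugeConfig 4 N 𝔾) (μ : ℝ) (s : Fin 4 → ℕ) (τ : ℝ),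
    (wilsonCell U μ 0 s + (Complex.I * (τ : ℂ)) • cellGammaFive s)ᴴ *
        (wilsonCell U μ 0 s + (Complex.I * (τ : ℂ)) • cellGammaFive s) =
      (wilsonCell U μ 0 s)ᴴ * wilsonCell U μ 0 s +
        ((τ ^ 2 : ℝ) : ℂ) • (1 : Matrix {p // wilsonBox (0 : TorusSite 4 N) s p}
          {p // wilsonBox (0 : TorusSite 4 N) s p} ℂ)

open scoped Classical in
/-- **TRANSFER C⁺ of card A (`TwistedSumLaw`).** Verbatim the crux `CoerciveSea` except that in
clause (i) the phase-quenched PROBABILITY of `HasSingularSeparator U (mq f) s (t/s₀)` is replaced by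
the phase-quenched EXPECTATION of the bounded analytic local observable
`min 1 (twistedSum U (mq f) s (t/s₀))`; clauses (ii), (iii) are kept verbatim (they are
`NegativeCellsDilute`, crux stmt-13900, not this card's subject). `TwistedCount` gives
`1_{HasSingularSeparator} ≤ min 1 twistedSum` pointwise, so `TwistedSumLaw → CoerciveSea` is
monotonicity of the integral (shape `Reduction`). -/
def TwistedSumLaw : Prop :=
  open Literature.MathematicalPhysics.QuantumLattice Literature.MathematicalPhysics.QuantumFieldTheory Literature.Probability.LatticeModels in ∀ Nf : ℕ, (Nf = 2 ∨ Nf = 3) → ∃ reg : QCDRegularisation Nf, reg.HasMassScaling ∧ (reg.scheme 0 0 0).HasAsymptoticScaling ∧ ∃ M₀ : ℝ, 0 ≤ M₀ ∧ ∃ b₀ : ℕ, 2 ≤ b₀ ∧ ∃ ℓ : ℝ, 0 < ℓ ∧ ∀ m : Fin Nf → ℝ, (∀ f, M₀ < m f) → ∃ R : ℝ, 0 < R ∧ (∃ C : ℝ, 0 < C ∧ ∃ α : ℝ, 0 < α ∧ ∀ᶠ k : ℕ in Filter.atTop, ∀ S : ℕ, R ≤ reg.a k * (2 * S + 1) → let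 N : ℕ := 2 * S + 1; let mq : Fin Nf → ℝ := fun f => reg.mcrit k + reg.a k * m f / reg.Zm k; let wt : GaugeConfig 4 N (Matrix.specialUnitaryGroup (Fin 3) ℂ) → ℝ := fun U => ∏ f, ‖fermionDet (wilsonDirac (fundamentalRep (Fin 3)) U (mq f) 1)‖; let Ex : (GaugeConfig 4 N (Matrix.specialUnitaryGroup (Fin 3) ℂ) → ℝ) → ℝ := fun F => (∫ U, F U * wt U ∂(wilsonMeasure (d := 4) (L := N) (fundamentalRep (Fin 3)) (reg.β k))) / (∫ U, wt U ∂(wilsonMeasure (d := 4) (L := N) (fundamentalRep (Fin 3)) (reg.β k))); ∀ s : Fin 4 → ℕ, (∀ i, b₀ ≤ s i ∧ s i ≤ N ∧ (s i : ℝ) * reg.a k ≤ ℓ) → (∀ i j, s i ≤ 2 * s j) → ∀ f : Fin Nf, ∀ t : ℝ, 0 < t → t ≤ 1 → Ex (fun U => min 1 (twistedSum U (mq f) s (t / s 0))) ≤ C * t ^ α) ∧ (∀ ε : ℝ, 0 < ε → ∀ᶠ k : ℕ in Filter.atTop, ∀ S : ℕ, R ≤ reg.a k * (2 * S + 1) →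 let N : ℕ := 2 * S + 1; let mq : Fin Nf → ℝ := fun f => reg.mcrit k + reg.a k * m f / reg.Zm k; let wt : GaugeConfig 4 N (Matrix.specialUnitaryGroup (Fin 3) ℂ) → ℝ := fun U => ∏ f, ‖fermionDet (wilsonDirac (fundamentalRep (Fin 3)) U (mq f) 1)‖; let P : (GaugeConfig 4 N (Matrix.specialUnitaryGroup (Fin 3) ℂ) → Prop) → ℝ := fun E => (∫ U, (if E U then (1 : ℝ) else 0) * wt U ∂(wilsonMeasure (d := 4) (L := N) (fundamentalRep (Fin 3)) (reg.β k))) / (∫ U, wt U ∂(wilsonMeasure (d := 4) (L := N) (fundamentalRep (Fin 3)) (reg.β k))); let J : ℕ := Nat.log 2 (⌊ℓ / reg.a k⌋₊ / b₀) + 1; ∃ δ : ℕ → ℝ, ∑ j ∈ Finset.range J, δ j ≤ ε ∧ ∀ j < J, ∀ s : Fin 4 → ℕ, (∀ i, b₀ * 2 ^ j ≤ s i ∧ s i < b₀ * 2 ^ (j + 2) ∧ s i ≤ N ∧ (s i : ℝ) * reg.a k ≤ ℓ) → P (fun U => ∃ f, IsSignDefect U (mq f) j s) ≤ δ j) ∧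 (∀ M : ℝ, M₀ < M → ∀ᶠ k : ℕ in Filter.atTop, ∀ S : ℕ, R ≤ reg.a k * (2 * S + 1) → let N : ℕ := 2 * S + 1; let mq : Fin Nf → ℝ := fun f => reg.mcrit k + reg.a k * m f / reg.Zm k; let wt : GaugeConfig 4 N (Matrix.specialUnitaryGroup (Fin 3) ℂ) → ℝ := fun U => ∏ f, ‖fermionDet (wilsonDirac (fundamentalRep (Fin 3)) U (mq f) 1)‖; (1 / 4 : ℝ) ≤ (∫ U, (if (fermionDet (wilsonDirac (fundamentalRep (Fin 3)) U (reg.mcrit k - reg.a k * M / reg.Zm k) 1)).re < 0 then (1 : ℝ) else 0) * wt U ∂(wilsonMeasure (d := 4) (L := N) (fundamentalRep (Fin 3)) (reg.β k))) / (∫ U, wt U ∂(wilsonMeasure (d := 4) (L := N) (fundamentalRep (Fin 3)) (reg.β k))))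

/-- The shape of the composition theorem a crux-plan line would check:
first lemma + transfer ⟹ the crux BY NAME. -/
def Reduction : Prop :=
  TwistedCount → TwistedSumLaw → Summit.QuantumFields.QCD.Theses.NestedDissectionSea.CoerciveSea

/-- The observable is BOUNDED configuration-free: each of the `12·#box` singular values contributes
`(τ²/(σ²+τ²))³ ≤ 1`, so `0 ≤ twistedSum ≤ 8 · 12 · #sites` — together with `CellTwistedSquare`
(`‖G_τ‖ ≤ 1/τ`) this is the "no exceptional configurations" property that makes `E[twistedSum]`
an expectation of a bounded analytic local observable. Provable now (size S–M). -/
def TwistedSumBounded : Prop :=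
  ∀ (N : ℕ) [NeZero N] (U : GaugeConfig 4 N 𝔾) (μ : ℝ) (s : Fin 4 → ℕ) (τ : ℝ), 0 < τ →
    0 ≤ twistedSum U μ s τ ∧
      twistedSum U μ s τ ≤ 8 * Fintype.card {p // wilsonBox (0 : TorusSite 4 N) s p}

/-! ## Card B — haar-link-gradient -/

/-- Left-rotate ONE link: `U ↦ U` with `U b` replaced by `g · U b`. Haar measure on the link is
invariant under this map for every fixed `g` — the absolutely continuous randomness of the lever. -/
def rotateLink (U : GaugeConfig 4 N 𝔾) (b : Literature.MathematicalPhysics.QuantumFieldTheory.Edge 4 N) (g : 𝔾) : GaugeConfig 4 N 𝔾 :=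
  Function.update U b (g * U b)

/-- The **chiral link transition amplitude** of a cell vector `ψ` across the link `(x, ν)` with a
colour insertion `M`: `J = Σ ψ̄(x,a,α) [γ₅(1 − γ_ν)]_{αβ} [M · U(x,ν)]_{ab} ψ(x + ν̂, b, β)` — the
analogue, for the Hermitian Wilson cell operator, of the eigenfunction CURRENT `j_ψ` that carries
`∂λ/∂ω` for random vector potentials (Erdős–Hasler 2012 §4). -/
def chiralLinkAmplitude (U : GaugeConfig 4 N 𝔾) (s : Fin 4 → ℕ) (x : TorusSite 4 N) (ν : Fin 4)
    (M : Matrix (Fin 3) (Fin 3) ℂ) (ψ : {p // wilsonBox (0 : TorusSite 4 N) s p} → ℂ) : ℂ :=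
  ∑ p : {p // wilsonBox (0 : TorusSite 4 N) s p}, ∑ q : {p // wilsonBox (0 : TorusSite 4 N) s p},
    if p.1.1 = x ∧ q.1.1 = Literature.MathematicalPhysics.QuantumFieldTheory.Site.shift x ν then
      star (ψ p) * (gammaFive * (1 - euclideanGamma ν)) p.1.2.2 q.1.2.2 *
        (M * fundamentalRep (Fin 3) (U (x, ν))) p.1.2.1 q.1.2.1 * ψ q
    else 0

/-- **FIRST LEMMA of card B (deterministic, provable now, size M): the law of motion in the links.**
Rotating the single link `(x, ν)` by `g ∈ SU(3)` changes the Hermitian cell form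
`ψ ↦ ⟨ψ, Γ₅ᶜ D_c ψ⟩` by EXACTLY minus the real part of the chiral link transition amplitude with
insertion `g − 1`: the two hopping blocks through the link contribute `−½ J` and `−½ J̄`
(`(γ₅(1+γ_ν))ᴴ = γ₅(1−γ_ν)`, `((gU)⁻¹ − U⁻¹)ᴴ = (g − 1)U` for unitary `g, U`). Its derivative at
`g = exp(θX)` is the Hellmann–Feynman speed `∂_θ λ = −Re J(ψ; X)` of an eigenvalue `λ` of
`H_c = Γ₅ᶜ D_c` with eigenvector `ψ` — sign-indefinite, like `⟨u, j_ψ⟩`, which is why the lever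
uses the SQUARED link gradient. (If either endpoint of the link lies outside the open box both sides
vanish.) -/
def LinkSpeedIdentity : Prop :=
  ∀ (N : ℕ) [NeZero N] (U : GaugeConfig 4 N 𝔾) (μ : ℝ) (s : Fin 4 → ℕ) (x : TorusSite 4 N)
    (ν : Fin 4) (g : 𝔾) (ψ : {p // wilsonBox (0 : TorusSite 4 N) s p} → ℂ),
    star ψ ⬝ᵥ (cellGammaFive s *
        (wilsonCell (rotateLink U (x, ν) g) μ 0 s - wilsonCell U μ 0 s)).mulVec ψ =
      -(((chiralLinkAmplitude U s x ν ((g : Matrix (Fin 3) (Fin 3) ℂ) - 1) ψ).re : ℝ) : ℂ)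

/-- **Spectral averaging by left translation (generic, provable now, size S–M).** For a left-invariant
measure `μ` on a group, a density `ρ` whose variation along the one-parameter family `γ` is bounded
by `K` for `|θ| ≤ T`, and any event `A`:
`(ρμ)(A) ≤ K/(2T) · ∫ Leb{θ ∈ [−T, T] : γ(θ)·h ∈ A} d(ρμ)(h)` (Fubini + left invariance). With
`μ` = Haar on the link group, `ρ` = the conditional phase-quenched density of one link (Gibbs factor ×
sea determinant ratio), `γ(θ) = exp(θX)`, and `A` = "the cell has an eigenvalue within `ε` of `0`",
the inner Lebesgue measure is the one-dimensional Wegner quantity controlled by the link speed. -/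
def HaarTranslationAveraging : Prop :=
  ∀ (G : Type) [Group G] [MeasurableSpace G] [MeasurableMul₂ G] (μ : Measure G)
    [μ.IsMulLeftInvariant] (ρ : G → ℝ≥0∞) (_hρ : Measurable ρ) (A : Set G) (_hA : MeasurableSet A)
    (γ : ℝ → G) (_hγ : Measurable γ) (T : ℝ) (K : ℝ≥0∞), 0 < T →
    (∀ θ : ℝ, |θ| ≤ T → ∀ g : G, ρ (γ θ * g) ≤ K * ρ g) →
    (μ.withDensity ρ) A ≤ K / ENNReal.ofReal (2 * T) *
      ∫⁻ h, volume {θ : ℝ | |θ| ≤ T ∧ γ θ * h ∈ A} ∂(μ.withDensity ρ)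

end Summit.QuantumFields.QCD.Cruxes.CoerciveSea.Ideator2
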